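import Mathlib
import Summits.HodgeConjecture.FermatCycles.HodgeFermatHypUAuto
import Summits.HodgeConjecture.FermatCycles.HodgeFermatHypVDefs

/-!
# HYPOTHESIS V on a finite range: the certificate-free kernel walk `walkV` and its soundness (`HodgeFermat/HypVCert.lean`; HF-G33)

Tree copy (whole module) of the module `HodgeFermat/HypVCert.lean` of the sibling cell's standalone package
`run/shared/lean/pub/pub-hodgefermat/lean/HodgeFermat/` (174 lines, sha256 `e5c954d117b1e633…`), source lines 25–174 (all: `vBound`, `sumV`, `checkLevelV`, `levelV`, the walk `walkV` and its soundness `vRange_of_walkV`, tests, the level `46189`).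
Filed by cell `pub-hfermat`, seat prover-1 gen-2, on the COORDINATOR KEEPER RULING of 2026-08-25 (gem sweep H1: take the
off-gate kernel theorem `thmFstar` through the gate) — here its second namesake, `HodgeFermat/ThmFstarNFinal.lean:29`,
THEOREM F*(3N) at every admissible squarefree level (the first, `DecodingFinal.thmFstar` = THEOREM F* at the prime levels,
landed on 2026-08-25 as `HodgeFermatThmFstar.lean`, seat prover-1 gen-0); this file is one link of the import closure of
`ThmFstarNFinal.thmFstar` on top of that landed chain.  The source module's declarations are VERBATIM those of the cell record
`check/ThmFstarN_standalone.lean` (21 bodies, 438 871 B, sha256 ced731ec52c92191…, hub `lean check` rc 0, 222.2 s, `--axioms …ThmFstarN.thmFstarN` = [propext, Classical.choice, Quot.sound]; pub-hodgefermat `CERT.md` l.987, GATE HF-G33).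
Deviations from the source module, exhaustively: the `import` lines (tree modules `Summits.HodgeConjecture.FermatCycles.
HodgeFermat*` instead of `HodgeFermat.*`); this module docstring; one-line docstrings added (gate lint) to `tauV_eq_of_vBound`, `sum_eq_of_sumV`, `ineqV_of_checkLevelV`, `levelV_sound`, `walkV_sound`, `vRange_mono`, `walkV_test`, `vRange_test`.
Every other line — in particular every declaration's statement and proof — is byte-identical to the source.
HONEST FRAMING: explicit algebraic cycles for specific Hodge classes on Fermat/Delsarte varieties; residual open instances
listed; no claim on general Hodge.  (This file is arithmetic of CM types / of `(ℤ/N)ˣ`; it claims nothing about cycles.)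

The source module's docstring (HypVCert.lean l.7–23), verbatim:

## HYPOTHESIS V on a finite range: the certificate-free kernel walk (HF-G33)

`HypVDefs.IneqV N : 12 + 12 · Σ_{q ∣ N} tauV N q < φ(N)`, `tauV N q = φ(N/q) / ord_{N/q}(q)`, decided level by
level INSIDE THE KERNEL exactly as `HypUAuto.lean` decides HYPOTHESIS U: for a squarefree level `N = p₁ ⋯ p_k`
(trial-division factorisation `HypUAuto.factor`, primality re-certified by `HypUCert.isPrimeB`) and each `p = p_i`,
`m = N / p`, the exact order `d = ord_m(p)` is COMPUTED (`HypUAuto.reduceOrd` from `λ(m) = lcm (p_j - 1)`) and then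
CERTIFIED by the sound checker `HypUCert.checkOrd` (`p^d ≡ 1`, `p^{d/r} ≢ 1` for the primes `r ∣ d`), giving
`tauV N p = (∏_{j ≠ i} (p_j - 1)) / d` exactly; the level passes iff `12 + 12 Σ < ∏ (p_i - 1)`.  Nothing about the
generator is proved: `checkLevelV_sound` rests on `checkOrd_sound`, `prime_of_isPrimeB`, `totient_prod_primes` only.

`walkV top fuel` walks `N = top - fuel, …, top - 1`, skipping the multiples of `2, 3, 5, 7` and refuting
squarefreeness by a square factor where the factorisation shows one; `vRange_of_walkV : walkV (a + k) k = true →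
VRange a (a + k)`.  One `decide +kernel` per 1000 levels (`HypVRange.lean`).

Imports `HypUAuto` (hence `HypUCert`, `HypUDefs`) and `HypVDefs`; Mathlib otherwise.  No `sorry`.
-/

set_option autoImplicit false

namespace HodgeFermat.KRFree.HypVCert

open Finset HodgeFermat.KRFree.HypUCert HodgeFermat.KRFree.HypUAuto HodgeFermat.KRFree.HypVDefs

/-! ## 1. One prime of a level: the exact order, certified, and the exact `tauV` -/

/-- for the prime `p` of the level with prime list `ps` (`m = N / p`): the exact order `d` of `p` mod `m`
(computed from `λ(m)`, then CHECKED by `checkOrd`) and the value `φ(m) / d`; `none` if the check fails. -/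
def vBound (N : ℕ) (ps : List ℕ) (p : ℕ) : Option ℕ :=
  let m := N / p
  let L := lam p ps
  let d := reduceOrd p m L (factor L)
  if checkOrd p m d (factor d) then some (((ps.erase p).map (· - 1)).prod / d) else none

/-- a checked `vBound` is the exact value of `tauV N p` -/
theorem tauV_eq_of_vBound (N : ℕ) (ps : List ℕ) (p b : ℕ) (hps : ∀ q ∈ ps, q.Prime) (hnd : ps.Nodup)
    (hN : ps.prod = N) (hp : p ∈ ps) (h : vBound N ps p = some b) : tauV N p = b := by
  have hp0 : 0 < p := (hps _ hp).pos
  have hm : N / p = (ps.erase p).prod :=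
    Nat.div_eq_of_eq_mul_right hp0 (by rw [← hN, ← List.prod_erase hp])
  have hps' : ∀ q ∈ ps.erase p, q.Prime := fun q hq => hps q (List.mem_of_mem_erase hq)
  have htot : (N / p).totient = ((ps.erase p).map (· - 1)).prod := by
    rw [hm]; exact totient_prod_primes _ hps' (hnd.erase _)
  unfold vBound at h
  simp only at h
  split_ifs at h with hc
  cases h
  unfold tauV
  rw [htot, checkOrd_sound _ _ _ _ hc]

/-- sum of the exact values over the prime list -/
def sumV (N : ℕ) (ps : List ℕ) : List ℕ → Option ℕ
  | [] => some 0
  | p :: l =>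
      match vBound N ps p, sumV N ps l with
      | some b, some s => some (b + s)
      | _, _ => none

/-- a checked `sumV` is the exact value of `Σ tauV` -/
theorem sum_eq_of_sumV (N : ℕ) (ps : List ℕ) (hps : ∀ q ∈ ps, q.Prime) (hnd : ps.Nodup) (hN : ps.prod = N) :
    ∀ (l : List ℕ) (s : ℕ), (∀ p ∈ l, p ∈ ps) → sumV N ps l = some s → (l.map (tauV N)).sum = s
  | [], s, _, h => by simp [sumV] at h; simp [h]
  | p :: l, s, hmem, h => by
      simp only [sumV] at h
      split at h
      · rename_i b s' hb hs'
        cases h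
        simp only [List.map_cons, List.sum_cons]
        rw [tauV_eq_of_vBound N ps p b hps hnd hN (hmem p (by simp)) hb,
          sum_eq_of_sumV N ps hps hnd hN l s' (fun q hq => hmem q (by simp [hq])) hs']
      · exact absurd h (by simp)

/-! ## 2. One level -/

/-- the level check: `ps` distinct certified primes with product `N` and `12 + 12 Σ tauV < ∏ (p - 1)` -/
def checkLevelV (N : ℕ) (ps : List ℕ) : Bool :=
  nodupB ps && ps.all isPrimeB && (ps.prod == N) &&
    (match sumV N ps ps with
     | some s => Nat.blt (12 + 12 * s) ((ps.map (· - 1)).prod)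
     | none => false)

/-- a checked level proves `IneqV N` -/
theorem ineqV_of_checkLevelV (N : ℕ) (ps : List ℕ) (h : checkLevelV N ps = true) : IneqV N := by
  simp only [checkLevelV, Bool.and_eq_true, List.all_eq_true, beq_iff_eq] at h
  obtain ⟨⟨⟨hndB, hallP⟩, hN⟩, hfin⟩ := h
  have hnd := nodup_of_nodupB ps hndB
  have hps : ∀ p ∈ ps, p.Prime := fun p hp => prime_of_isPrimeB p (hallP p hp)
  split at hfin
  · rename_i s hs
    simp only [Nat.blt_eq] at hfin
    have hsum := sum_eq_of_sumV N ps hps hnd hN ps s (fun p hp => hp) hs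
    have hpf : N.primeFactors = ps.toFinset := hN ▸ primeFactors_prod_primes ps hps hnd
    have htot : N.totient = (ps.map (· - 1)).prod := hN ▸ totient_prod_primes ps hps hnd
    unfold IneqV
    rw [hpf, List.sum_toFinset _ hnd, htot]
    have hsum' : (ps.map (fun p => tauV N p)).sum = s := hsum
    rw [hsum']
    exact hfin
  · exact absurd hfin (by simp)

/-- the in-kernel decision of one level `N` prime to `210`: a square factor found (then `N` is not squarefree and
there is nothing to show), or the composite/prime squarefree level checked by `checkLevelV` on its prime list -/
def levelV (N : ℕ) : Bool :=
  match (factor N).find? (fun qe => Nat.ble 2 qe.2) with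
  | some qe => Nat.ble 2 qe.1 && (N % (qe.1 * qe.1) == 0)
  | none => checkLevelV N ((factor N).map Prod.fst)

/-- soundness of the one-level decision `levelV` (squarefree `N`) -/
theorem levelV_sound (N : ℕ) (h : levelV N = true) (hsq : Squarefree N) : IneqV N := by
  unfold levelV at h
  split at h
  · rename_i qe _
    simp only [Bool.and_eq_true, Nat.ble_eq, beq_iff_eq] at h
    have hqq : qe.1 * qe.1 ∣ N := Nat.dvd_of_mod_eq_zero h.2
    have := Nat.isUnit_iff.mp (hsq qe.1 hqq)
    omega
  · exact ineqV_of_checkLevelV N _ h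

/-! ## 3. The walk -/

/-- Walk `N = top - fuel, …, top - 1`; multiples of `2, 3, 5, 7` are skipped, every other `N` must pass `levelV`. -/
def walkV (top : ℕ) : ℕ → Bool
  | 0 => true
  | fuel + 1 =>
      if (top - (fuel + 1)) % 2 = 0 ∨ (top - (fuel + 1)) % 3 = 0 ∨ (top - (fuel + 1)) % 5 = 0 ∨
          (top - (fuel + 1)) % 7 = 0 then walkV top fuel
      else levelV (top - (fuel + 1)) && walkV top fuel

/-- soundness of the walk `walkV` -/
theorem walkV_sound (top : ℕ) : ∀ fuel : ℕ, walkV top fuel = true →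
    ∀ n, top - fuel ≤ n → n < top → Squarefree n → ¬ 2 ∣ n → ¬ 3 ∣ n → ¬ 5 ∣ n → ¬ 7 ∣ n → IneqV n
  | 0, _, n, h1, h2, _, _, _, _, _ => by omega
  | fuel + 1, h, n, h1, h2, hsq, h2n, h3n, h5n, h7n => by
      unfold walkV at h
      split_ifs at h with hdiv
      · rcases Nat.eq_or_lt_of_le h1 with heq | hlt
        · exfalso
          rw [heq] at hdiv
          rcases hdiv with h0 | h0 | h0 | h0
          · exact h2n (Nat.dvd_of_mod_eq_zero h0)
          · exact h3n (Nat.dvd_of_mod_eq_zero h0)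
          · exact h5n (Nat.dvd_of_mod_eq_zero h0)
          · exact h7n (Nat.dvd_of_mod_eq_zero h0)
        · exact walkV_sound top fuel h n (by omega) h2 hsq h2n h3n h5n h7n
      · simp only [Bool.and_eq_true] at h
        rcases Nat.eq_or_lt_of_le h1 with heq | hlt
        · rw [heq] at h
          exact levelV_sound n h.1 hsq
        · exact walkV_sound top fuel h.2 n (by omega) h2 hsq h2n h3n h5n h7n

/-- The range statement `VRange a (a + k)` of `HypVDefs.lean` from a checked walk. -/
theorem vRange_of_walkV (a k : ℕ) (hw : walkV (a + k) k = true) : VRange a (a + k) :=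
  fun n ha hb hsq h2 h3 h5 h7 => walkV_sound (a + k) k hw n (by omega) hb hsq h2 h3 h5 h7

/-- shrink the upper end of a range of HYPOTHESIS V -/
theorem vRange_mono {a b b' : ℕ} (h : VRange a b) (hb : b' ≤ b) : VRange a b' :=
  fun N ha hc hsq h2 h3 h5 h7 => h N ha (lt_of_lt_of_le hc hb) hsq h2 h3 h5 h7

/-! ## 4. Tests -/

/-- the composite levels `143 = 11·13`, `46189 = 11·13·17·19` pass; the prime `23` and `253 = 11 · 23` (worst
composite ratio `36/55`) behave as computed by hand -/
theorem checkLevelV_test :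
    (checkLevelV 143 [11, 13], checkLevelV 46189 [11, 13, 17, 19], checkLevelV 23 [23], checkLevelV 253 [11, 23])
      = (true, true, false, true) := by decide +kernel

/-- the test walk `25 ≤ N < 300` checks (kernel evaluation) -/
theorem walkV_test : walkV 300 275 = true := by decide +kernel

/-- HYPOTHESIS V for `25 ≤ N < 300` from the test walk -/
theorem vRange_test : VRange 25 300 := vRange_of_walkV 25 275 walkV_test

/-- the single level `46189 = 11 · 13 · 17 · 19` beyond the walked range needed by the tail (`HypVTail.lean`) -/
theorem ineqV_46189 : IneqV 46189 := ineqV_of_checkLevelV 46189 [11, 13, 17, 19] (by decide +kernel)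

end HodgeFermat.KRFree.HypVCert
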